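import Mathlib
import Summits.NavierStokesRegularity.NavierStokesRegularity.Theorems.EulerZoomLiouvillePowerGaugeEulerLiouvilleBootstrapStep
import HarnessLib

/-!
# The GLOBAL ENERGY INEQUALITY of Seregin's power-gauged class, THRESHOLD-FREE (every `ρ ≥ 0`)
# (crux `EulerZoomLiouville.PowerGaugeEulerLiouville` = stmt-NavierStokesRegularity-19832, lead's line `birth`)

Route `EulerZoomLiouville` (NavierStokesRegularity).  Completion of successor target S1 of the lead report v5: the
BOOTSTRAP IN SCALE.  For a member of the class (any `ρ ≥ 0`) and a.e. start time `s₀ < 0`, the total energy never exceeds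
its value at `s₀` afterwards:

* `lintegral_enorm_sq_antitone_ae_of_gauge` — for a.e. `s₀ < 0` and then a.e. `t ∈ (s₀, 0)`:
  `∫_{ℝ³} |u(t)|² ≤ ∫_{ℝ³} |u(s₀)|²` (extended reals; vacuous iff the energy at `s₀` is infinite).

Compare `…EnergyMonotone.powerGauge_energy_antitone_ae` (`2/5 < ρ`), `…WindowFluxTwoNinths` (`2/9 < ρ`),
`…FiniteEnergyStrata` (all `ρ`, but uniformly finite energy assumed): here NO threshold and NO extra hypothesis.  Proof: if
`∫|u(s₀)|² = E₀ < ∞`, start from the `A`-gauge slice profile `∫_{B_r}|u(t)|² ≤ c' r^{max(1−2ρ,0)}` and apply the bootstrap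
step `sliceProfile_bootstrap_step` seven times (each lowers the exponent by `1/6`, clamped at `0`); the last step gives
`∫_{B_r}|u(t)|² ≤ E₀ + A' r^{−1/6}` for a.e. `t > s₀`, and `r → ∞`.  Consequences (next file): «no Euler collapse from rest /
from an energy-quiescent past / backward-tight» for EVERY `ρ` — the open core of the crux is EXACTLY the set of members whose
energy is present at `t = −∞` (the self-similar/DSS window).  WHAT THIS IS NOT: not NS, not the open core; structure of the
class, kernel-checked, `--supports` stmt-19832. [folklore]
-/

noncomputable section

set_option linter.dupNamespace false

open MeasureTheory Set Filter Topology Metric Function TopologicalSpace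
open scoped ENNReal NNReal InnerProductSpace RealInnerProductSpace Laplacian

namespace Summit.NavierStokesRegularity.NavierStokesRegularity.Theorems.PowerGaugeEulerLiouville

open Literature.Analysis Literature.Analysis.FunctionSpaces Literature.Analysis.FluidPDE

/-- **The global energy inequality of the power-gauged class, for every `ρ ≥ 0`.**  See the file docstring. [folklore] -/
theorem lintegral_enorm_sq_antitone_ae_of_gauge {ρ : ℝ} (hρ : 0 ≤ ρ)
    {u : ℝ → EuclideanSpace ℝ (Fin 3) → EuclideanSpace ℝ (Fin 3)} {p : ℝ → EuclideanSpace ℝ (Fin 3) → ℝ}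
    {H : ℝ → EuclideanSpace ℝ (Fin 3) → EuclideanSpace ℝ (Fin 3) →L[ℝ] EuclideanSpace ℝ (Fin 3)} {c : ℝ≥0}
    (hsw : IsSuitableWeakSolutionOn (slab (EuclideanSpace ℝ (Fin 3)) (Iio 0) isOpen_Iio) 0 0 u p)
    (hH : HasWeakSpatialGradientOn (slab (EuclideanSpace ℝ (Fin 3)) (Iio 0) isOpen_Iio) u H)
    (hc : ∀ a : ℝ, 0 < a → ENNReal.ofReal (a ^ (2 * ρ)) * cknA a (0 : ℝ × EuclideanSpace ℝ (Fin 3)) u +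
        ENNReal.ofReal (a ^ ρ) * cknE a (0 : ℝ × EuclideanSpace ℝ (Fin 3)) H +
        ENNReal.ofReal (a ^ (2 * ρ)) * cknD a (0 : ℝ × EuclideanSpace ℝ (Fin 3)) p ≤ (c : ℝ≥0∞)) :
    ∀ᵐ s ∂(volume : Measure ℝ), s < 0 → ∀ᵐ t ∂(volume : Measure ℝ), t ∈ Ioo s 0 →
      ∫⁻ x, ‖u t x‖ₑ ^ 2 ≤ ∫⁻ x, ‖u s x‖ₑ ^ 2 := by
  have hE : ∀ a : ℝ, 0 < a →
      ENNReal.ofReal (a ^ ρ) * cknE a (0 : ℝ × EuclideanSpace ℝ (Fin 3)) H ≤ (c : ℝ≥0∞) :=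
    fun a ha => le_trans (le_trans le_add_self le_self_add) (hc a ha)
  have hAg := hasScaledLocalEnergyBound_of_gaugeA (ρ := ρ)
    (fun a ha => le_trans (le_trans le_self_add le_self_add) (hc a ha))
  have hu3 := locallyIntegrableOn_cube_of_gauge hsw hH hE
  obtain ⟨C, -, hcut⟩ := cutoffFacts
  -- the cut-off family of the bootstrap step
  have hφ : ∀ k : ℕ, ContDiff ℝ (⊤ : ℕ∞) (cutoff (E := EuclideanSpace ℝ (Fin 3)) ((k : ℝ) + 1)) :=
    fun k => (hcut _ (by positivity)).1
  have hφc : ∀ k : ℕ, HasCompactSupport (cutoff (E := EuclideanSpace ℝ (Fin 3)) ((k : ℝ) + 1)) :=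
    fun k => (hcut _ (by positivity)).2.1
  have hφ0 : ∀ (k : ℕ) x, 0 ≤ cutoff (E := EuclideanSpace ℝ (Fin 3)) ((k : ℝ) + 1) x :=
    fun k => (hcut _ (by positivity)).2.2.1
  have hslab : ∀ n : ℕ, Ioo (-((n : ℝ) + 2)) 0 ×ˢ (univ : Set (EuclideanSpace ℝ (Fin 3))) ⊆
      ((slab (EuclideanSpace ℝ (Fin 3)) (Iio 0) isOpen_Iio : Opens (ℝ × EuclideanSpace ℝ (Fin 3))) :
        Set (ℝ × EuclideanSpace ℝ (Fin 3))) := by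
    intro n z hz
    rw [SetLike.mem_coe, mem_slab]
    exact hz.1.2
  -- the sliced energy inequality from a.e. start, all cut-offs `k`, all windows `n`
  set Ineq : ℕ → ℝ → ℝ → Prop := fun k s₀ t =>
    ∫ x, ‖u t x‖ ^ 2 * cutoff (E := EuclideanSpace ℝ (Fin 3)) ((k : ℝ) + 1) x ≤
      (∫ x, ‖u s₀ x‖ ^ 2 * cutoff (E := EuclideanSpace ℝ (Fin 3)) ((k : ℝ) + 1) x) +
      ∫ z in Ico s₀ t ×ˢ (univ : Set (EuclideanSpace ℝ (Fin 3))),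
        (‖u z.1 z.2‖ ^ 2 * (0 * (Δ (cutoff (E := EuclideanSpace ℝ (Fin 3)) ((k : ℝ) + 1))) z.2) +
          (‖u z.1 z.2‖ ^ 2 + 2 * p z.1 z.2) *
            ⟪u z.1 z.2, gradient (cutoff (E := EuclideanSpace ℝ (Fin 3)) ((k : ℝ) + 1)) z.2⟫) with hIneq
  have hmono : ∀ n k : ℕ, ∀ᵐ s₀ ∂(volume : Measure ℝ), s₀ ∈ Ioo (-((n : ℝ) + 1)) (-(1 / ((n : ℝ) + 1))) →
      ∀ᵐ t ∂(volume : Measure ℝ), t ∈ Ioo s₀ (-(1 / ((n : ℝ) + 1))) → Ineq k s₀ t := by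
    intro n k
    have hn1 : (0 : ℝ) < 1 / ((n : ℝ) + 1) := by positivity
    exact SuitableRestart.ae_energy_le_of_start_Ioo hsw le_rfl hu3 (hslab n) (hφ k) (hφc k) (hφ0 k)
      (a' := -((n : ℝ) + 1)) (b' := -(1 / ((n : ℝ) + 1))) (by linarith) (by linarith)
  have hreg : ∀ᵐ s ∂(volume : Measure ℝ), s < 0 → AEStronglyMeasurable (u s) volume := by
    have h := ae_hasWeakGradient_slice_of_slab_Iio hH
    rw [ae_restrict_iff' measurableSet_Iio] at h
    filter_upwards [h] with s hs hslt
    have hl : LocallyIntegrable (u s) volume := locallyIntegrableOn_univ.1 (by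
      simpa only [Opens.coe_top] using (hs hslt).locallyIntegrableOn)
    exact hl.aestronglyMeasurable
  have hgood := ae_all_iff.2 fun n => ae_all_iff.2 fun k => hmono n k
  filter_upwards [hgood, hreg] with s₀ hgs hregs hs₀neg
  have hmeas₀ := hregs hs₀neg
  -- nothing to prove if the energy at `s₀` is infinite
  by_cases htop : ∫⁻ x, ‖u s₀ x‖ₑ ^ 2 = ⊤
  · exact Eventually.of_forall fun t _ => by rw [htop]; exact le_top
  set E₀ : ℝ≥0 := (∫⁻ x, ‖u s₀ x‖ₑ ^ 2).toNNReal with hE₀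
  have hE₀eq : (E₀ : ℝ≥0∞) = ∫⁻ x, ‖u s₀ x‖ₑ ^ 2 := ENNReal.coe_toNNReal htop
  have hE₀le : ∫⁻ x, ‖u s₀ x‖ₑ ^ 2 ≤ (E₀ : ℝ≥0∞) := hE₀eq.ge
  -- ## the base slice profile from the `A`-gauge: exponent `e₀ = max(1 − 2ρ, 0) ∈ [0,1]`
  set e₀ : ℝ := max (1 - 2 * ρ) 0 with he₀
  have he₀0 : 0 ≤ e₀ := le_max_right _ _
  have he₀1 : e₀ ≤ 1 := max_le (by linarith) zero_le_one
  set L : ℝ := Real.sqrt (-s₀) + 1 with hL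
  have hL1 : 1 ≤ L := by rw [hL]; linarith [Real.sqrt_nonneg (-s₀)]
  have hL0 : 0 < L := lt_of_lt_of_le one_pos hL1
  have hbase : ∀ t : ℝ, t ∈ Ioo s₀ 0 → ∀ r : ℝ, 1 ≤ r →
      ∫⁻ x in ball (0 : EuclideanSpace ℝ (Fin 3)) r, ‖u t x‖ₑ ^ 2 ≤ ENNReal.ofReal ((c : ℝ) * L ^ e₀ * r ^ e₀) := by
    intro t ht r hr
    have hr0 : 0 < r := lt_of_lt_of_le one_pos hr
    set r' : ℝ := r * L with hr'
    have hr'1 : 1 ≤ r' := by rw [hr']; nlinarith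
    have hr'0 : 0 < r' := lt_of_lt_of_le one_pos hr'1
    have hrr' : r ≤ r' := by rw [hr']; nlinarith
    have htQ : t ∈ Ioo (-(r' ^ 2)) 0 := by
      refine ⟨?_, ht.2⟩
      have h1 : Real.sqrt (-s₀) ^ 2 = -s₀ := Real.sq_sqrt (by linarith)
      have h2 : Real.sqrt (-s₀) ≤ r' := by
        rw [hr', hL]; nlinarith [Real.sqrt_nonneg (-s₀)]
      nlinarith [ht.1, Real.sqrt_nonneg (-s₀)]
    have h := hAg r' hr'0 t htQ
    refine ((lintegral_mono_set (ball_subset_ball hrr')).trans h).trans (ENNReal.ofReal_le_ofReal ?_)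
    rw [mul_assoc]
    refine mul_le_mul_of_nonneg_left ?_ c.2
    -- `r'^{1-2ρ} ≤ L^{e₀} r^{e₀}`
    rcases le_or_gt 0 (1 - 2 * ρ) with hpos | hneg
    · have : e₀ = 1 - 2 * ρ := max_eq_left hpos
      rw [this, hr', Real.mul_rpow hr0.le hL0.le, mul_comm]
    · have : e₀ = 0 := max_eq_right hneg.le
      rw [this, Real.rpow_zero, Real.rpow_zero, mul_one]
      exact Real.rpow_le_one_of_one_le_of_nonpos hr'1 hneg.le
  -- ## on each window `(s₀, b_n)`, `b_n = −1/(n+1)`: the iteration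
  have hwin : ∀ n : ℕ, s₀ ∈ Ioo (-((n : ℝ) + 1)) (-(1 / ((n : ℝ) + 1))) →
      ∀ᵐ t ∂(volume.restrict (Ioo s₀ (-(1 / ((n : ℝ) + 1))))), ∫⁻ x, ‖u t x‖ₑ ^ 2 ≤ (E₀ : ℝ≥0∞) := by
    intro n hsn
    set b : ℝ := -(1 / ((n : ℝ) + 1)) with hb
    have hb0 : b < 0 := by rw [hb]; exact neg_neg_of_pos (by positivity)
    have hs₀b : s₀ < b := hsn.2
    have hstart : ∀ k : ℕ, ∀ᵐ t ∂(volume.restrict (Ioo s₀ b)), Ineq k s₀ t := by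
      intro k
      rw [ae_restrict_iff' measurableSet_Ioo]
      exact hgs n k hsn
    -- the profiles `P j`: exponent `e j = max(e₀ − j/6, 0)`
    set ex : ℕ → ℝ := fun j => max (e₀ - (j : ℝ) / 6) 0 with hex
    have hex0 : ∀ j, 0 ≤ ex j := fun j => le_max_right _ _
    have hex1 : ∀ j, ex j ≤ 1 := fun j => max_le (by
      have : (0:ℝ) ≤ (j : ℝ) / 6 := by positivity
      linarith) zero_le_one
    have hP : ∀ j : ℕ, ∃ A : ℝ≥0, ∀ᵐ t ∂(volume.restrict (Ioo s₀ b)), ∀ r : ℝ, 1 ≤ r →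
        ∫⁻ x in ball (0 : EuclideanSpace ℝ (Fin 3)) r, ‖u t x‖ₑ ^ 2 ≤ ENNReal.ofReal ((A : ℝ) * r ^ ex j) := by
      intro j
      induction j with
      | zero =>
        refine ⟨⟨(c : ℝ) * L ^ e₀, by positivity⟩, ?_⟩
        have hex0' : ex 0 = e₀ := by simp only [hex, Nat.cast_zero, zero_div, sub_zero]; exact max_eq_left he₀0
        rw [ae_restrict_iff' measurableSet_Ioo]
        refine Eventually.of_forall fun t ht r hr => ?_
        rw [hex0']
        exact hbase t ⟨ht.1, lt_trans ht.2 hb0⟩ r hr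
      | succ j ih =>
        obtain ⟨A, hA⟩ := ih
        obtain ⟨A', hA'⟩ := sliceProfile_bootstrap_step hρ (hex0 j) (hex1 j) hsw hH hc hs₀b hb0.le hmeas₀ hE₀le
          hstart hA
        refine ⟨⟨(E₀ : ℝ) + A', by positivity⟩, ?_⟩
        filter_upwards [hA'] with t ht r hr
        refine (ht r hr).trans (ENNReal.ofReal_le_ofReal ?_)
        have hr0 : 0 < r := lt_of_lt_of_le one_pos hr
        have h1 : (1 : ℝ) ≤ r ^ ex (j + 1) := Real.one_le_rpow hr (hex0 _)
        have h2 : r ^ (ex j - 1 / 6) ≤ r ^ ex (j + 1) := by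
          refine Real.rpow_le_rpow_of_exponent_le hr ?_
          simp only [hex]
          rcases le_or_gt 0 (e₀ - (j : ℝ) / 6) with hp | hn
          · rw [max_eq_left hp]
            refine le_trans (le_of_eq ?_) (le_max_left _ _)
            push_cast; ring
          · rw [max_eq_right hn.le]
            exact le_trans (by norm_num) (le_max_right _ _)
        change (E₀ : ℝ) + (A' : ℝ) * r ^ (ex j - 1 / 6) ≤ ((E₀ : ℝ) + A') * r ^ ex (j + 1)
        rw [add_mul]
        exact add_le_add (le_mul_of_one_le_right E₀.2 h1) (mul_le_mul_of_nonneg_left h2 A'.2)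
    -- after six steps the exponent is `0`; one more step gives `E₀ + A' r^{-1/6}`
    obtain ⟨A6, hA6⟩ := hP 6
    have hex6 : ex 6 = 0 := by
      simp only [hex]; refine max_eq_right ?_; push_cast; linarith
    rw [hex6] at hA6
    obtain ⟨A', hA'⟩ := sliceProfile_bootstrap_step hρ le_rfl zero_le_one hsw hH hc hs₀b hb0.le hmeas₀ hE₀le
      hstart hA6
    filter_upwards [hA'] with t ht
    -- `∫ |u(t)|² = sup_m ∫_{B_{m+1}} |u(t)|² ≤ E₀`
    have hlim : Tendsto (fun m : ℕ => ENNReal.ofReal ((E₀ : ℝ) + A' * ((m : ℝ) + 1) ^ ((0 : ℝ) - 1 / 6)))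
        atTop (𝓝 (ENNReal.ofReal ((E₀ : ℝ) + A' * 0))) := by
      refine ENNReal.tendsto_ofReal (tendsto_const_nhds.add (Tendsto.const_mul _ ?_))
      have h1 : Tendsto (fun m : ℕ => (m : ℝ) + 1) atTop atTop :=
        tendsto_natCast_atTop_atTop.atTop_add tendsto_const_nhds
      have h2 := (tendsto_rpow_neg_atTop (by norm_num : (0 : ℝ) < 1 / 6)).comp h1
      refine h2.congr fun m => ?_
      simp only [comp_apply]; norm_num
    rw [mul_zero, add_zero, ENNReal.ofReal_coe_nnreal] at hlim
    have hballs : ∀ m₀ : ℕ, ∫⁻ x in ball (0 : EuclideanSpace ℝ (Fin 3)) ((m₀ : ℝ) + 1), ‖u t x‖ₑ ^ 2 ≤ (E₀ : ℝ≥0∞) := by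
      intro m₀
      refine ge_of_tendsto hlim (Filter.eventually_atTop.2 ⟨m₀, fun m hm => ?_⟩)
      have hmm : (m₀ : ℝ) + 1 ≤ (m : ℝ) + 1 := by
        have : (m₀ : ℝ) ≤ m := by exact_mod_cast hm
        linarith
      exact (lintegral_mono_set (ball_subset_ball hmm)).trans
        (ht ((m : ℝ) + 1) (by linarith [(Nat.cast_nonneg m : (0:ℝ) ≤ m)]))
    have hcov : (⋃ m : ℕ, ball (0 : EuclideanSpace ℝ (Fin 3)) ((m : ℝ) + 1)) = univ := by
      refine eq_univ_of_forall fun x => ?_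
      obtain ⟨m, hm⟩ := exists_nat_gt ‖x‖
      exact mem_iUnion.2 ⟨m, mem_ball_zero_iff.2 (by linarith)⟩
    have hdir : Directed (· ⊆ ·) fun m : ℕ => ball (0 : EuclideanSpace ℝ (Fin 3)) ((m : ℝ) + 1) := by
      refine Monotone.directed_le fun i j hij => ball_subset_ball ?_
      have : (i : ℝ) ≤ j := by exact_mod_cast hij
      linarith
    calc ∫⁻ x, ‖u t x‖ₑ ^ 2
        = ∫⁻ x in (⋃ m : ℕ, ball (0 : EuclideanSpace ℝ (Fin 3)) ((m : ℝ) + 1)), ‖u t x‖ₑ ^ 2 := by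
          rw [hcov, Measure.restrict_univ]
      _ = ⨆ m : ℕ, ∫⁻ x in ball (0 : EuclideanSpace ℝ (Fin 3)) ((m : ℝ) + 1), ‖u t x‖ₑ ^ 2 :=
          setLIntegral_iUnion_of_directed _ hdir
      _ ≤ (E₀ : ℝ≥0∞) := iSup_le hballs
  -- ## assemble over the windows
  have hall : ∀ᵐ t ∂(volume : Measure ℝ), ∀ n : ℕ, s₀ ∈ Ioo (-((n : ℝ) + 1)) (-(1 / ((n : ℝ) + 1))) →
      t ∈ Ioo s₀ (-(1 / ((n : ℝ) + 1))) → ∫⁻ x, ‖u t x‖ₑ ^ 2 ≤ (E₀ : ℝ≥0∞) := by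
    refine ae_all_iff.2 fun n => ?_
    by_cases hsn : s₀ ∈ Ioo (-((n : ℝ) + 1)) (-(1 / ((n : ℝ) + 1)))
    · have h := hwin n hsn
      rw [ae_restrict_iff' measurableSet_Ioo] at h
      filter_upwards [h] with t ht _ htm
      exact ht htm
    · exact Eventually.of_forall fun t h => (hsn h).elim
  filter_upwards [hall] with t ht htmem
  have hst : s₀ < t := htmem.1
  have htneg : t < 0 := htmem.2
  set n : ℕ := ⌈-s₀⌉₊ + ⌈1 / (-t)⌉₊ with hn
  have hn1 : -((n : ℝ) + 1) < s₀ := by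
    have h1 : -s₀ ≤ (⌈-s₀⌉₊ : ℝ) := Nat.le_ceil _
    have h2 : (n : ℝ) = (⌈-s₀⌉₊ : ℝ) + (⌈1 / (-t)⌉₊ : ℝ) := by rw [hn]; push_cast; ring
    have h3 : (0 : ℝ) ≤ (⌈1 / (-t)⌉₊ : ℝ) := by positivity
    linarith
  have hn2 : t < -(1 / ((n : ℝ) + 1)) := by
    have h1 : 1 / (-t) ≤ (⌈1 / (-t)⌉₊ : ℝ) := Nat.le_ceil _
    have h2 : (n : ℝ) = (⌈-s₀⌉₊ : ℝ) + (⌈1 / (-t)⌉₊ : ℝ) := by rw [hn]; push_cast; ring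
    have h3 : (0 : ℝ) ≤ (⌈-s₀⌉₊ : ℝ) := by positivity
    have h4 : 1 / (-t) < (n : ℝ) + 1 := by linarith
    have hnt : 0 < -t := by linarith
    rw [div_lt_iff₀ hnt] at h4
    have h5 : 1 / ((n : ℝ) + 1) < -t := by
      rw [div_lt_iff₀ (by positivity), mul_comm]; exact h4
    linarith
  rw [← hE₀eq]
  exact ht n ⟨hn1, hst.trans hn2⟩ ⟨hst, hn2⟩

end Summit.NavierStokesRegularity.NavierStokesRegularity.Theorems.PowerGaugeEulerLiouville

end
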